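import Literature.AnabelianGeometry.EtaleTheta.Discharge.Sec2Cor218ivTrivialBaseDY
import Literature.AnabelianGeometry.EtaleTheta.Discharge.Sec2TowerLemmas
import HarnessLib

/-!
# [EtTh] Cor. 2.19 (i) (cyclotomic rigidity) for `RigidData` with TRIVIAL base group `G_K = 1`:
# commutator criteria for the two FACT rows F-0626 `Cor219_i_splittings` / F-0627 `Cor219_i_subquotients`
# (proof-only)

S. Mochizuki, *The Étale Theta Function …* [EtTh], Publ. RIMS **45** (2009), §2, Def. 2.13 (i)–(ii) p. 47,
Prop. 2.14 (i) p. 49 (the MECHANISM "`γ(β)·β⁻¹`": the `Gal(Y/X)`-part of `D_Y` recovers `s^alg(l·Δ_Θ)`),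
Cor. 2.19 (i) pp. 64–66 (locators `p.N` = PDF pages; bib key `MochizukiEtTh2009`).

PROOF-ONLY companion (no `def`, no instance, no new named fact) of abc-iut-L2-t2's `ThetaRigidity.lean`
(`RigidData.Cor219_i_subquotients`, `RigidData.Cor219_i_splittings`, `algImage`, `thetaImage`), over a
`R : RigidData N l` whose base group is trivial (`[Subsingleton R.G]`, so the envelope `Π^tp_Y[μ_N]` is the
direct product `μ_N × Π^tp_Y` with `μ_N` central).  The cell's dischargers of record for the two rows
(abc-iut-L2-d1's `cor219_i_subquotients_of` / `cor219_i_splittings_of`) consume F-0620 `Cor218_i`, F-0622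
`Cor218_iii_PiX` (temp-slimness) and F-0623 `Cor218_iii_quotient`; at `G_K = 1` toys the last two FAIL
(`μ_N` and the centre of `Π^tp_Y` are central), so a different route is needed there:

* `apply_mul_inv_mem_algImage_of_mk_mem_DY` — every representative `φ` of an element of `D_Y` acts as
  `id × conj_g` (f-151's `left_eq_of_mk_mem_DY` + L2-d1's `exists_over_of_mk_mem_DY`), hence
  `φ(x)·x⁻¹ ∈ s^alg(l·Δ_Θ)` as soon as the commutators `[Π^tp_X, Π^tp_Y]` lie in `l·Δ_Θ`;
* `map_algImage_lDeltaTheta_le_of_iso` / `…_eq_of_iso` — for a model automorphism `α`, `α ∘ conj_a ∘ α⁻¹`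
  represents an element of `D_Y` (clause `D_Y ↦ D_Y`), and `s^alg(w) = conj_a(s^alg y)·(s^alg y)⁻¹` when
  `w = [a, y]`; so `α(s^alg(l·Δ_Θ)) = s^alg(l·Δ_Θ)` whenever `l·Δ_Θ = {[a, y] | y ∈ Π^tp_Y}` for ONE `a`
  (the reverse inclusion via L2-d1's `exists_iso_symm`);
* `ThetaEnvData.map_ker_proj_eq_of_torsionFree` — if `Π^tp_Y` has no `N`-torsion, `μ_N ⊆ Π^tp_Y[μ_N]` is the
  `N`-torsion, hence stable under EVERY group automorphism; `ThetaEnvData.map_range_sTheta_eq_of_iso` —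
  `Im(s^Θ)` is stable (its `μ_N`-conjugacy class is a singleton);
* `map_thetaImage_lDeltaTheta_eq_of_iso` — hence `α(s^Θ(l·Δ_Θ)) = s^Θ(l·Δ_Θ)` (L2-d1's
  `thetaImage_eq_range_inf` / `algImage_sup_ker_eq`);
* **`cor219_i_subquotients_of_commutators`**, **`cor219_i_splittings_of_commutators`** — the two rows under:
  `G_K = 1`, `Ker(Π^tp_X ↠ (Π^tp_X)^Θ) = 1` (subquotients only), `[Π^tp_X, Π^tp_Y] ⊆ l·Δ_Θ = {[a, ·]}`,
  `Π^tp_Y` `N`-torsion-free.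

Consumed by `ThetaRigidityHeisenbergCor219i.lean` (the discrete Heisenberg skeleton of `(Π^tp_X)^Θ`, where the
two rows HOLD while F-0622/F-0623 FAIL).  HONEST FRAMING: statements about the cell's own typing over an
abstract interface; print's Cor. 2.19 (i) concerns the tempered fundamental group of a specific curve and is
neither proved nor refuted here; nothing bears on [IUTchIII] Cor. 3.12; no side taken; typed ≠ proved.
Cell `abc-iut`, seat abc-iut-w6-d089 (rows F-0626 / F-0627).
-/

namespace Literature.AnabelianGeometry.EtaleTheta

universe u

/-! ## §1. `ThetaEnvData`-level stability lemmas -/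

namespace ThetaEnvData

variable {N : ℕ+} (T : ThetaEnvData.{u} N)

/-- **`μ_N` is the `N`-torsion of `Π^tp_Y[μ_N]` when `Π^tp_Y` has no `N`-torsion**, hence `Ker(Π• ↠ Π•_Y)`
is stable under every group automorphism of the envelope. [cite: MochizukiEtTh2009, Cor 2.18(iii) p.61] -/
theorem map_ker_proj_eq_of_torsionFree (htf : ∀ y : T.PiY, y ^ (N : ℕ) = 1 → y = 1)
    (A : T.env ≃* T.env) :
    (CycEnvelope.proj T.augY T.chi).ker.map A.toMonoidHom = (CycEnvelope.proj T.augY T.chi).ker := by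
  have key : ∀ x : T.env, x ∈ (CycEnvelope.proj T.augY T.chi).ker ↔ x ^ (N : ℕ) = 1 := by
    intro x
    rw [MonoidHom.mem_ker]
    constructor
    · intro hx
      have hx' : x.right = 1 := hx
      calc x ^ (N : ℕ)
          = (CycEnvelope.inMu T.augY T.chi x.left *
              CycEnvelope.algSection T.augY T.chi x.right) ^ (N : ℕ) := by
            rw [CycEnvelope.inMu_mul_algSection]
        _ = CycEnvelope.inMu T.augY T.chi (x.left ^ (N : ℕ)) := by
            rw [hx', map_one, mul_one, map_pow]
        _ = 1 := by rw [← T.card_mu, pow_card_eq_one, map_one]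
    · intro hx
      have h1 : (CycEnvelope.proj T.augY T.chi x) ^ (N : ℕ) = 1 := by
        rw [← map_pow, hx, map_one]
      exact htf _ h1
  ext z
  constructor
  · rintro ⟨x, hx, rfl⟩
    rw [SetLike.mem_coe, key] at hx
    rw [key, ← map_pow, hx, map_one]
  · intro hz
    refine ⟨A.symm z, ?_, A.apply_symm_apply z⟩
    rw [key] at hz
    rw [SetLike.mem_coe, key, ← map_pow, hz, map_one]

variable [Subsingleton T.G]

/-- With `G_K = 1`, every automorphism of the model `M(η)` maps `Im(s^Θ_Ÿ)` ONTO itself (its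
`μ_N`-conjugacy class is a singleton). [cite: MochizukiEtTh2009, Def 2.13(ii) p.47] -/
theorem map_range_sTheta_eq_of_iso {η : T.PiYdd → T.mu} {hη : η ∈ T.thetaCocycles}
    (α : (T.modelMono hη).Iso (T.modelMono hη)) :
    (T.sTheta hη).range.map α.e.toMulEquiv.toMonoidHom = (T.sTheta hη).range := by
  have hS := α.map_sTheta
  change (fun H => H.map α.e.toMulEquiv.toMonoidHom) ''
      CycEnvelope.muConjClass _ _ (T.sTheta hη).range =
    CycEnvelope.muConjClass _ _ (T.sTheta hη).range at hS
  rw [muConjClass_eq_singleton_of_subsingleton, Set.image_singleton,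
    Set.singleton_eq_singleton_iff] at hS
  exact hS

end ThetaEnvData

/-! ## §2. `RigidData`-level criteria for Cor. 2.19 (i) at `G_K = 1` -/

namespace RigidData

variable {N : ℕ+} {l : ℕ} (R : RigidData.{u} N l) [Subsingleton R.G]

/-- **`D_Y` moves points inside `s^alg(l·Δ_Θ)`** (`G_K = 1`): if the commutators `[Π^tp_X, Π^tp_Y]` lie in
`l·Δ_Θ`, then for every representative `φ` of an element of `D_Y` and every `x ∈ Π^tp_Y[μ_N]`,
`φ(x)·x⁻¹ ∈ s^alg(l·Δ_Θ)` — `φ` acts as `id × conj_g`. [cite: MochizukiEtTh2009, Prop 2.14(i) p.49] -/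
theorem apply_mul_inv_mem_algImage_of_mk_mem_DY
    (hcomm : ∀ (g : R.PiX) (y : R.PiY), g * (y : R.PiX) * g⁻¹ * (y : R.PiX)⁻¹ ∈ R.lDeltaTheta)
    (φ : contMulAut R.env) (hφ : TopOut.mk _ φ ∈ R.DY) (x : R.env) :
    (φ : MulAut R.env) x * x⁻¹ ∈ R.algImage R.lDeltaTheta := by
  obtain ⟨g, hg⟩ := R.toThetaEnvData.exists_over_of_mk_mem_DY φ hφ
  have hl : ((φ : MulAut R.env) x).left = x.left := R.toThetaEnvData.left_eq_of_mk_mem_DY φ hφ x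
  have hw : g * (x.right : R.PiX) * g⁻¹ * (x.right : R.PiX)⁻¹ ∈ R.lDeltaTheta := hcomm g x.right
  have hwdd : g * (x.right : R.PiX) * g⁻¹ * (x.right : R.PiX)⁻¹ ∈ R.PiYdd :=
    (Subgroup.mem_inf.mp (R.lDeltaTheta_le hw)).1
  refine ⟨⟨_, hwdd⟩, Subgroup.mem_subgroupOf.mpr hw, ?_⟩
  refine SemidirectProduct.ext ?_ ?_
  · rw [R.toThetaEnvData.mul_left_eq, R.toThetaEnvData.inv_left_eq, hl, mul_inv_cancel]
    rfl
  · apply Subtype.ext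
    change g * (x.right : R.PiX) * g⁻¹ * (x.right : R.PiX)⁻¹ = ((((φ : MulAut R.env) x * x⁻¹).right : R.PiY) : R.PiX)
    rw [SemidirectProduct.mul_right, SemidirectProduct.inv_right, Subgroup.coe_mul, Subgroup.coe_inv, hg]

/-- **`α(s^alg(l·Δ_Θ)) ⊆ s^alg(l·Δ_Θ)`** for every automorphism `α` of the model `M(η)` (`G_K = 1`), provided
`[Π^tp_X, Π^tp_Y] ⊆ l·Δ_Θ` and `l·Δ_Θ = {[a, y] : y ∈ Π^tp_Y}` for some `a ∈ Π^tp_X`: write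
`s^alg([a, y]) = conj_a(s^alg y)·(s^alg y)⁻¹` and use that `α ∘ conj_a ∘ α⁻¹` represents an element of `D_Y`
(clause `D_Y ↦ D_Y` of Def. 2.13 (ii)). [cite: MochizukiEtTh2009, Cor 2.19(i) p.64] -/
theorem map_algImage_lDeltaTheta_le_of_iso
    (hcomm : ∀ (g : R.PiX) (y : R.PiY), g * (y : R.PiX) * g⁻¹ * (y : R.PiX)⁻¹ ∈ R.lDeltaTheta)
    (a : R.PiX) (hgen : ∀ w ∈ R.lDeltaTheta, ∃ y : R.PiY, a * (y : R.PiX) * a⁻¹ * (y : R.PiX)⁻¹ = w)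
    {η : R.PiYdd → R.mu} {hη : η ∈ R.thetaCocycles} (α : (R.modelMono hη).Iso (R.modelMono hη)) :
    (R.algImage R.lDeltaTheta).map α.e.toMulEquiv.toMonoidHom ≤ R.algImage R.lDeltaTheta := by
  rintro _ ⟨z, hz, rfl⟩
  obtain ⟨⟨w, hwdd⟩, hw, rfl⟩ := hz
  obtain ⟨y, hy⟩ := hgen w (Subgroup.mem_subgroupOf.mp hw)
  -- `d := α ∘ conj_a ∘ α⁻¹` represents an element of `D_Y`
  have hd : TopOut.mk _ (conjContAut α.e
      ⟨R.toThetaEnvData.conjX a, R.toThetaEnvData.conjX_mem_contMulAut a⟩) ∈ R.DY := by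
    have h := α.map_D
    change R.DY.map (TopOut.transport α.e) = R.DY at h
    rw [← h]
    exact ⟨_, R.toThetaEnvData.mk_conjX_mem_DY a, rfl⟩
  -- `s^alg(w) = conj_a(s^alg y) · (s^alg y)⁻¹`
  have hkey : R.toThetaEnvData.sAlg ⟨w, hwdd⟩ =
      R.toThetaEnvData.conjX a (CycEnvelope.algSection R.augY R.chi y) *
        (CycEnvelope.algSection R.augY R.chi y)⁻¹ := by
    refine SemidirectProduct.ext ?_ ?_
    · rw [R.toThetaEnvData.mul_left_eq, R.toThetaEnvData.inv_left_eq]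
      change (1 : R.mu) = R.chi (R.aug a) (1 : R.mu) * (1 : R.mu)⁻¹
      rw [map_one, inv_one, mul_one]
    · apply Subtype.ext
      change w = a * (y : R.PiX) * a⁻¹ * (y : R.PiX)⁻¹
      exact hy.symm
  rw [hkey, map_mul, map_inv]
  have happ : α.e.toMulEquiv.toMonoidHom
      (R.toThetaEnvData.conjX a (CycEnvelope.algSection R.augY R.chi y)) =
      ((conjContAut α.e ⟨R.toThetaEnvData.conjX a, R.toThetaEnvData.conjX_mem_contMulAut a⟩ :
        contMulAut R.env) : MulAut R.env) (α.e (CycEnvelope.algSection R.augY R.chi y)) := by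
    rw [ThetaEnvData.conjContAut_apply, ContinuousMulEquiv.symm_apply_apply]
    rfl
  rw [happ]
  exact R.apply_mul_inv_mem_algImage_of_mk_mem_DY hcomm _ hd (α.e (CycEnvelope.algSection R.augY R.chi y))

/-- **`α(s^alg(l·Δ_Θ)) = s^alg(l·Δ_Θ)`** (`G_K = 1`, commutator hypotheses as above): the reverse inclusion
by the same argument for the inverse isomorphism (L2-d1's `exists_iso_symm`). This is the algebraic clause of
`Cor219_i_splittings` and, with `μ_N`, clause 2 of `Cor219_i_subquotients`.
[cite: MochizukiEtTh2009, Cor 2.19(i) p.64] -/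
theorem map_algImage_lDeltaTheta_eq_of_iso
    (hcomm : ∀ (g : R.PiX) (y : R.PiY), g * (y : R.PiX) * g⁻¹ * (y : R.PiX)⁻¹ ∈ R.lDeltaTheta)
    (a : R.PiX) (hgen : ∀ w ∈ R.lDeltaTheta, ∃ y : R.PiY, a * (y : R.PiX) * a⁻¹ * (y : R.PiX)⁻¹ = w)
    {η : R.PiYdd → R.mu} {hη : η ∈ R.thetaCocycles} (α : (R.modelMono hη).Iso (R.modelMono hη)) :
    (R.algImage R.lDeltaTheta).map α.e.toMulEquiv.toMonoidHom = R.algImage R.lDeltaTheta := by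
  refine le_antisymm (R.map_algImage_lDeltaTheta_le_of_iso hcomm a hgen α) fun z hz => ?_
  obtain ⟨β, hβ⟩ := ThetaEnvData.exists_iso_symm α
  have h := R.map_algImage_lDeltaTheta_le_of_iso hcomm a hgen β ⟨z, hz, rfl⟩
  refine ⟨β.e.toMulEquiv.toMonoidHom z, h, ?_⟩
  change α.e (β.e z) = z
  rw [hβ]
  exact α.e.apply_symm_apply z

/-- **`α(s^Θ_η(l·Δ_Θ)) = s^Θ_η(l·Δ_Θ)`** (`G_K = 1`, commutator hypotheses, `Π^tp_Y` `N`-torsion-free):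
`s^Θ(l·Δ_Θ) = Im(s^Θ) ∩ (μ_N · s^alg(l·Δ_Θ))` and each factor is stable. The theta clause of
`Cor219_i_splittings`. [cite: MochizukiEtTh2009, Cor 2.19(i) p.64] -/
theorem map_thetaImage_lDeltaTheta_eq_of_iso
    (hcomm : ∀ (g : R.PiX) (y : R.PiY), g * (y : R.PiX) * g⁻¹ * (y : R.PiX)⁻¹ ∈ R.lDeltaTheta)
    (a : R.PiX) (hgen : ∀ w ∈ R.lDeltaTheta, ∃ y : R.PiY, a * (y : R.PiX) * a⁻¹ * (y : R.PiX)⁻¹ = w)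
    (htf : ∀ y : R.PiY, y ^ (N : ℕ) = 1 → y = 1)
    {η : R.PiYdd → R.mu} (hη : η ∈ R.thetaCocycles) (α : (R.modelMono hη).Iso (R.modelMono hη)) :
    (R.thetaImage hη R.lDeltaTheta).map α.e.toMulEquiv.toMonoidHom = R.thetaImage hη R.lDeltaTheta := by
  have hdd : R.lDeltaTheta ≤ R.PiYdd := fun _ h => (Subgroup.mem_inf.mp (R.lDeltaTheta_le h)).1
  rw [R.thetaImage_eq_range_inf hη, Subgroup.map_inf_eq _ _ _ α.e.injective,
    R.toThetaEnvData.map_range_sTheta_eq_of_iso α, ← R.algImage_sup_ker_eq _ hdd, Subgroup.map_sup,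
    R.map_algImage_lDeltaTheta_eq_of_iso hcomm a hgen α,
    R.toThetaEnvData.map_ker_proj_eq_of_torsionFree htf α.e.toMulEquiv]

/-- **Cor. 2.19 (i), subquotients (row F-0627), commutator criterion at `G_K = 1`**: if
`Ker(Π^tp_X ↠ (Π^tp_X)^Θ) = 1`, `[Π^tp_X, Π^tp_Y] ⊆ l·Δ_Θ = {[a, y]}` for one `a`, and `Π^tp_Y` has no
`N`-torsion, then every automorphism of every model `M(η)` preserves `s^alg(Ker ↠ Θ)` (`= 1`),
`μ_N · s^alg(l·Δ_Θ)` and `Δ^tp_Y[μ_N]` (`= Π^tp_Y[μ_N]` here): `Cor219_i_subquotients` HOLDS — with F-0622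
(temp-slimness) and F-0623 allowed to fail. [cite: MochizukiEtTh2009, Cor 2.19(i) p.64] -/
theorem cor219_i_subquotients_of_commutators (h0 : R.thetaKer = ⊥)
    (hcomm : ∀ (g : R.PiX) (y : R.PiY), g * (y : R.PiX) * g⁻¹ * (y : R.PiX)⁻¹ ∈ R.lDeltaTheta)
    (a : R.PiX) (hgen : ∀ w ∈ R.lDeltaTheta, ∃ y : R.PiY, a * (y : R.PiX) * a⁻¹ * (y : R.PiX)⁻¹ = w)
    (htf : ∀ y : R.PiY, y ^ (N : ℕ) = 1 → y = 1) :
    Literature.AnabelianGeometry.EtaleTheta.RigidData.Cor219_i_subquotients R := by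
  intro η hη α
  refine ⟨?_, ?_, ?_⟩
  · have hb : R.algImage R.thetaKer = ⊥ := by
      change (R.thetaKer.subgroupOf R.PiYdd).map _ = ⊥
      rw [h0, Subgroup.bot_subgroupOf, Subgroup.map_bot]
    rw [hb, Subgroup.map_bot]
  · rw [Subgroup.map_sup, R.map_algImage_lDeltaTheta_eq_of_iso hcomm a hgen α,
      R.toThetaEnvData.map_ker_proj_eq_of_torsionFree htf α.e.toMulEquiv]
  · have htop : CycEnvelope.deltaEnv R.augY R.chi = ⊤ := by
      refine top_unique fun x _ => ?_
      rw [CycEnvelope.mem_deltaEnv_iff, MonoidHom.mem_ker]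
      exact Subsingleton.elim _ _
    rw [htop]
    exact Subgroup.map_top_of_surjective _ fun z => ⟨α.e.symm z, α.e.apply_symm_apply z⟩

/-- **Cor. 2.19 (i), the two splittings (row F-0626), commutator criterion at `G_K = 1`**: under
`[Π^tp_X, Π^tp_Y] ⊆ l·Δ_Θ = {[a, y]}` and `Π^tp_Y` `N`-torsion-free, every automorphism of every model `M(η)`
preserves BOTH `s^alg(l·Δ_Θ)` and `s^Θ_η(l·Δ_Θ)`: `Cor219_i_splittings` HOLDS (hence the model's cyclotomic
rigidity isomorphism `thetaMod`, `sAlg_mul_sTheta_inv`, is an invariant). [cite: MochizukiEtTh2009, Cor 2.19(i) p.64] -/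
theorem cor219_i_splittings_of_commutators
    (hcomm : ∀ (g : R.PiX) (y : R.PiY), g * (y : R.PiX) * g⁻¹ * (y : R.PiX)⁻¹ ∈ R.lDeltaTheta)
    (a : R.PiX) (hgen : ∀ w ∈ R.lDeltaTheta, ∃ y : R.PiY, a * (y : R.PiX) * a⁻¹ * (y : R.PiX)⁻¹ = w)
    (htf : ∀ y : R.PiY, y ^ (N : ℕ) = 1 → y = 1) :
    Literature.AnabelianGeometry.EtaleTheta.RigidData.Cor219_i_splittings R :=
  fun _ hη α => ⟨R.map_algImage_lDeltaTheta_eq_of_iso hcomm a hgen α,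
    R.map_thetaImage_lDeltaTheta_eq_of_iso hcomm a hgen htf hη α⟩

end RigidData

end Literature.AnabelianGeometry.EtaleTheta
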